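import Summits.BirchSwinnertonDyer.Rank1Residual.X11b.BDPRouteCyclotomicRecord
import Literature.NumberTheory.EllipticCurves.Disegni2020.PAdicBSDRankOneMultiplicativeProofs
import HarnessLib

/-!
# Class X11b, route p2 × the cyclotomic lever: the same theorems with Disegni's display taken from the
# registry's PRIMARY typings A185/A186 (`Disegni2020.padicBSD_nonsplitMult_rankOne`,
# `Disegni2020.padicBSD_splitMult_rankOne`) instead of `thm1_padicBSD_rankOne_multiplicative`
# (cell `b2b-bsdres`, sub-cell `multr1-p2`, gen 21 — dedup robustness)

HONEST FRAMING (verbatim, cell `b2b-bsdres`, run/shared/lean/b2b/bsd-rank1-residual/): the goal of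
the cell is to DELETE the COMBINATION-SHAPED residual classes for ALL analytic-rank `≤ 1` curves
over `ℚ` — "full BSD formula for every rank `≤ 1` curve in class `C`" assembled STRICTLY from
published theorems — so that the rank-`≤ 1` remainder becomes exactly the CONSTRUCTION-SHAPED
classes, which are TYPED (missing-input Props), NOT attempted; this is not "finishing BSD".
Research route `p2` for class X11b; no claim beyond the stated class and loci; nothing booked; X11b
stays CONSTRUCTION-SHAPED. THEOREMS ONLY (no definition, no named fact, no `sorry`).

## What this file does

Disegni 2020 Thm. 1/4 is typed in the tree several times (five seats raced on 2026-08-21); the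
referee's registry calls `padicBSD_nonsplitMult_rankOne` (A185) / `padicBSD_splitMult_rankOne`
(A186) PRIMARY and `Disegni2020/PAdicBSDRankOneMultiplicativeProofs.lean` derives the other typings'
clauses from them at a pair. The lever files of this seat (`BDPRouteCyclotomicLever{,Class}`,
`…Record`, `…Certificate`) follow the class-closure lane and bind
`thm1_padicBSD_rankOne_multiplicative`. Should the registry retire that typing, nothing is lost: the
datum-level theorems take the display AT THE PAIR, and this file re-instantiates the class-level
ones from A185/A186 (+ Gross–Zagier I.(7.3) for the rationality of `#Ш_an`, through
`Disegni2020.exists_rat_shaAn_eq_of_analyticRank_eq_one`):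
* `finite_sha_and_padicValNat_shaOrder_le_of_katoSurj_nonsplit_primary` (A185; any odd `p`),
  `…_split_primary` (A186; `p ≥ 5`, `E[p]` irreducible, a second multiplicative prime);
* `missingUpperBoundAt_of_katoSurj_of_regulatorNonvanishing_primary` (both signs, `p ≥ 5`, `Surj`);
* `P2.bsdp_of_surj_of_regulatorNonvanishing_primary` — the headline composition with the route's
  open input, A185/A186-bound.
CONDITIONAL; nothing booked; labels UNCHANGED.

References: [Disegni2020] Thm. 4 (both bullets), Prop. 2, Prop. 4–5; [Venerucci2015] Thm. D;
[GrossZagier1986] Thm. I.(7.3); [Wuthrich2014] Thm. 3; [SteinWuthrich2013] Thm. 6.1, §4.2;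
[Miller2011LMS] Def. 1.1.
-/

set_option autoImplicit false

noncomputable section

open scoped Classical MatrixGroups ModularForm

open CongruenceSubgroup WeierstrassCurve NumberField IsDedekindDomain Field
open Literature.NumberTheory.EllipticCurves Literature.NumberTheory.EllipticCurves.GreenbergSelmer
  Literature.NumberTheory.EllipticCurves.ModularForms
  Literature.NumberTheory.EllipticCurves.Rank1Residual
  Literature.NumberTheory.EllipticCurves.Rank1Residual.Typed
  Literature.NumberTheory.EllipticCurves.Wuthrich2014
  Literature.NumberTheory.EllipticCurves.SteinWuthrich2013
  Literature.NumberTheory.EllipticCurves.Disegni2020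
  Literature.NumberTheory.EllipticCurves.Skinner2016
  Literature.NumberTheory.EllipticCurves.BalakrishnanEtAl2019
  Literature.NumberTheory.QuadraticFields.Quadratic
  Literature.NumberTheory.Automorphic
  Literature.NumberTheory.GaloisRepresentations Literature.NumberTheory.GaloisCohomology

namespace Summit.BirchSwinnertonDyer.Rank1Residual.X11b

variable (W : WeierstrassCurve ℚ) [W.IsElliptic] [W.IsGloballyMinimal] (p : ℕ) [Fact p.Prime]

/-- **Euler-system half, NON-SPLIT `p`, ANY odd `p`, onto `p`-adic image — Disegni's display from the
PRIMARY typing A185** (`padicBSD_nonsplitMult_rankOne`, exact identity with multiplier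
`1 − (−1)⁻¹ = 2`, unit `1`). Otherwise as
`finite_sha_and_padicValNat_shaOrder_le_of_katoSurj_nonsplit_of_schneider`. CONDITIONAL; nothing
booked. [cite: Disegni2020, Thm. 4 (first bullet), Prop. 2] [cite: Wuthrich2014, Thm. 3 (p. 383)]
[cite: SteinWuthrich2013, Thm. 6.1 (p. 20), §4.2] [cite: Miller2011LMS, Def. 1.1] -/
theorem finite_sha_and_padicValNat_shaOrder_le_of_katoSurj_nonsplit_primary
    (hK : kato_charIdeal_dvd_multiplicative_of_surjective) (hJ : thm61_nonsplitMultiplicative)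
    (hH : exists_isMultCanonical) (h₁ : padicBSD_nonsplitMult_rankOne)
    (hGZK : rank_eq_analyticRank_of_analyticRank_le_one)
    (hpar : nonempty_modularParametrizationData)
    (hp : p ≠ 2) (hmult : W.HasMultiplicativeReductionAtPrime p)
    (hns : ¬ W.HasSplitMultiplicativeReductionAtPrime p) (hr : W.analyticRank = 1)
    (hρ : ∀ n : ℕ, W.HasSurjectiveModNGaloisRep (p ^ n : ℕ))
    (hSch : ∀ (q : ℚ_[p]) (Dh : PAdicHeightData W p), q ≠ 0 → ‖q‖ < 1 → tateJ q = (W.j : ℚ_[p]) →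
      IsMultCanonical Dh q → SchneiderConjecture Dh)
    {s : ℚ} (hs : shaAn W = (s : ℂ)) :
    Finite W.sha ∧ (padicValNat p W.shaOrder : ℤ) ≤ padicValRat p s := by
  obtain ⟨κ, hκ, γ, hγ, hγ'⟩ := exists_isCyclotomic_isTopGenerator_isCyclotomicVariable_holds p
  obtain ⟨D⟩ := W.nonempty_selmerDualData_holds κ γ hγ
  haveI : NeZero (W.conductorNorm ℤ) := ⟨(W.conductorNorm_pos_holds).ne'⟩
  obtain ⟨Dm⟩ := hpar W
  obtain ⟨ϖ, hϖpos, hϖ, -⟩ := Dm.exists_rat_mul_realPeriodRat_eq_plusPeriod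
  obtain ⟨L, hL⟩ := exists_isMultPAdicLFunctionOf_neg_one_of_nonsplit Dm.isNewformOf hmult hns
  obtain ⟨q, ⟨hq0, hq1, hqj⟩, -⟩ := existsUnique_tateJ_eq_of_one_lt_norm
    (one_lt_norm_j_of_hasMultiplicativeReductionAtPrime (W := W) (p := p) hmult)
  obtain ⟨Dh, hDh⟩ := hH W p hp hmult hns q hq0 hq1 hqj
  obtain ⟨hXt, hnsp, -⟩ := hK W p hp hmult hρ hκ hγ hγ' Dm.isNewformOf D ϖ hϖ
  obtain ⟨g', hg', hdiv'⟩ := hnsp hns L hL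
  obtain ⟨g, hg⟩ := (charIdeal_isPrincipal_holds p D.X).principal
  have hchar : D.charIdeal = Ideal.span {g} := hg
  rw [hchar] at hg'
  obtain ⟨h, hgh⟩ := Ideal.mem_span_singleton'.mp hg'
  have hdiv : iwasawaToPowerSeries p (g * h) = PowerSeries.C ((ϖ : ℚ) : ℚ_[p]) * L := by
    rw [mul_comm, hgh]; exact hdiv'
  have hDis := padicBSD_nonsplitMult_rankOne.identity_two h₁ W p hp hmult hns hr hq0 hq1 hqj
    Dm.isNewformOf hL hDh hϖ hs
  exact finite_sha_and_padicValNat_shaOrder_le_of_nonsplit_divisibility W p hJ hGZK hp hr hmult hns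
    hq0 hq1 hqj hκ hγ hγ' D hXt hchar h hdiv Dh hDh hs 1 (by simpa using hDis) (hSch q Dh hq0 hq1 hqj hDh)

/-- **Euler-system half, SPLIT `p ≥ 5`, `E[p]` irreducible, a second multiplicative prime — Disegni's
display from the PRIMARY typing A186** (`padicBSD_splitMult_rankOne`, clause 3: exact identity).
CONDITIONAL; nothing booked. [cite: Disegni2020, Thm. 4 (second bullet), Prop. 4, Prop. 5]
[cite: Venerucci2015, Thm. D] [cite: Wuthrich2014, Thm. 3 (p. 383)] [cite: SteinWuthrich2013, Thm. 6.1, §4.2] -/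
theorem finite_sha_and_padicValNat_shaOrder_le_of_katoSurj_split_primary
    (hK : kato_charIdeal_dvd_multiplicative_of_surjective) (hJ : thm61_splitMultiplicative)
    (hH : exists_isSplitMultCanonical) (h₂ : padicBSD_splitMult_rankOne)
    (hGZK : rank_eq_analyticRank_of_analyticRank_le_one)
    (hpar : nonempty_modularParametrizationData)
    (hp5 : 5 ≤ p) (hmult : W.HasMultiplicativeReductionAtPrime p)
    (hsplit : W.HasSplitMultiplicativeReductionAtPrime p) (hirr : W.HasIrreducibleModPGaloisRep p)
    (hr : W.analyticRank = 1) (hρ : ∀ n : ℕ, W.HasSurjectiveModNGaloisRep (p ^ n : ℕ))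
    (hm : ∃ (m : ℕ) (_ : Fact m.Prime), m ≠ p ∧ W.HasMultiplicativeReductionAtPrime m)
    (hSch : ∀ (Dq : TateParameterData W p) (Dh : PAdicHeightData W p),
      IsSplitMultCanonical Dh Dq → SchneiderConjecture Dh)
    {s : ℚ} (hs : shaAn W = (s : ℂ)) :
    Finite W.sha ∧ (padicValNat p W.shaOrder : ℤ) ≤ padicValRat p s := by
  have hp2 : p ≠ 2 := by omega
  obtain ⟨κ, hκ, γ, hγ, hγ'⟩ := exists_isCyclotomic_isTopGenerator_isCyclotomicVariable_holds p
  obtain ⟨D⟩ := W.nonempty_selmerDualData_holds κ γ hγ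
  haveI : NeZero (W.conductorNorm ℤ) := ⟨(W.conductorNorm_pos_holds).ne'⟩
  obtain ⟨Dm⟩ := hpar W
  obtain ⟨ϖ, hϖpos, hϖ, -⟩ := Dm.exists_rat_mul_realPeriodRat_eq_plusPeriod
  obtain ⟨L, hL⟩ := exists_isSplitMultPAdicLFunctionOf hsplit Dm.isNewformOf
  obtain ⟨Dq⟩ := (nonempty_tateParameterData_iff_holds (W := W) (p := p)).mpr hsplit
  obtain ⟨Dh, hDh⟩ := hH W p hp2 Dq
  obtain ⟨hXt, -, hsp⟩ := hK W p hp2 hmult hρ hκ hγ hγ' Dm.isNewformOf D ϖ hϖ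
  obtain ⟨g', hg', hdiv'⟩ := hsp hsplit L hL
  obtain ⟨g, hg⟩ := (charIdeal_isPrincipal_holds p D.X).principal
  have hchar : D.charIdeal = Ideal.span {g} := hg
  rw [hchar] at hg'
  obtain ⟨h, hgh⟩ := Ideal.mem_span_singleton'.mp hg'
  have hdiv : iwasawaToPowerSeries p ((PowerSeries.X : IwasawaAlgebra p) * g * h) =
      PowerSeries.C ((ϖ : ℚ) : ℚ_[p]) * L := by
    rw [show (PowerSeries.X : IwasawaAlgebra p) * g * h = PowerSeries.X * g' by rw [← hgh]; ring]
    exact hdiv'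
  have hDis := (h₂ W p hp5 Dq hirr hr Dm.f Dm.isNewformOf L hL Dh hDh ϖ hϖ s hs).2.2 hm
  exact finite_sha_and_padicValNat_shaOrder_le_of_split_divisibility W p hJ hGZK hp2 hr Dq hκ hγ hγ' D
    hXt hchar h hdiv Dh hDh hs 1 (by simpa using hDis) (hSch Dq Dh hDh)

/-- **The Euler-system half on a surjective rank-one pair at a multiplicative `p ≥ 5`, A185/A186-bound**
(+ Gross–Zagier I.(7.3) for `#Ш_an ∈ ℚ`), per-pair input `ClassClosure.RegulatorNonvanishingAt W p`
and Disegni's (∗) as `hstar`; `E[p]` irreducible from `Surj` is asked explicitly (`hirr`, the class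
predicate carries it). CONDITIONAL; nothing booked. [cite: Disegni2020, Thm. 4] [cite: GrossZagier1986, Thm. I.(7.3) 2)]
[cite: Wuthrich2014, Thm. 3, Cor. 19 proof (p. 399)] [cite: SteinWuthrich2013, Thm. 6.1, §4.2] [cite: Miller2011LMS, Def. 1.1] -/
theorem missingUpperBoundAt_of_katoSurj_of_regulatorNonvanishing_primary
    (hK : kato_charIdeal_dvd_multiplicative_of_surjective)
    (hJn : thm61_nonsplitMultiplicative) (hJs : thm61_splitMultiplicative)
    (hHn : exists_isMultCanonical) (hHs : exists_isSplitMultCanonical)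
    (h₁ : padicBSD_nonsplitMult_rankOne) (h₂ : padicBSD_splitMult_rankOne)
    (hGZ : GrossZagier1986_thm_I_7_3)
    (hGZK : rank_eq_analyticRank_of_analyticRank_le_one)
    (hpar : nonempty_modularParametrizationData)
    (hp5 : 5 ≤ p) (hmult : W.HasMultiplicativeReductionAtPrime p)
    (hirr : W.HasIrreducibleModPGaloisRep p) (hr : W.analyticRank = 1) (hsurj : Surj W p)
    (hstar : W.HasSplitMultiplicativeReductionAtPrime p →
      ∃ (m : ℕ) (_ : Fact m.Prime), m ≠ p ∧ W.HasMultiplicativeReductionAtPrime m)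
    (hReg : ClassClosure.RegulatorNonvanishingAt W p) :
    Typed.MissingUpperBoundAt W p := by
  have hρ := kato_charIdeal_dvd_multiplicative_of_surjective.surjective_pow_of_five_le W p hp5 hsurj
  obtain ⟨s, hs⟩ := Disegni2020.exists_rat_shaAn_eq_of_analyticRank_eq_one hGZ hGZK W hr
  refine ⟨s, hs, ?_⟩
  by_cases hsplit : W.HasSplitMultiplicativeReductionAtPrime p
  · exact (finite_sha_and_padicValNat_shaOrder_le_of_katoSurj_split_primary W p hK hJs hHs h₂ hGZK hpar
      hp5 hmult hsplit hirr hr hρ (hstar hsplit) hReg.2 hs).2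
  · exact (finite_sha_and_padicValNat_shaOrder_le_of_katoSurj_nonsplit_primary W p hK hJn hHn h₁ hGZK
      hpar (by omega) hmult hsplit hr hρ hReg.1 hs).2

/-- **Route p2 × the lever, A185/A186-bound: `BSD(E,p)` at every X11b pair with `p ≥ 5` and `ρ̄`
onto** from the route's published facts + THE open input at the pair + the lever's published facts
(Kato, SW 6.1 ×2, SW §4.2 ×2, Disegni PRIMARY ×2, Gross–Zagier I.(7.3), modular parametrisation) +
`RegulatorNonvanishingAt W p` + (∗). `P2.bsdp_of_surj_of_regulatorNonvanishing` with the other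
Disegni typing. CONDITIONAL; nothing booked. [cite: Disegni2020, Thm. 4] [cite: Castella2018Erratum, (2.4)]
[cite: Miller2011LMS, Def. 1.1] -/
theorem P2.bsdp_of_surj_of_regulatorNonvanishing_primary
    (hGZ : ∀ (N : ℕ) [NeZero N] (W : WeierstrassCurve ℚ) (K : Type) [Field K] [NumberField K],
      gross_zagier N W K)
    (hKo : ∀ (N : ℕ) [NeZero N] (W : WeierstrassCurve ℚ) (K : Type) [Field K] [NumberField K],
      kolyvagin N W K)
    (hWu : sha_dvd_analyticSha)
    (hGZK : rank_eq_analyticRank_of_analyticRank_le_one) (hmod : hasEntireLFunction_rat)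
    (hnf : exists_isNewformOf) (hHL : HoffsteinLuo1997_exists_twist_L_one_ne_zero)
    (hMaz : mazur_not_dvd_maninConstant_of_odd)
    (hPT : ∀ (K : Type) [Field K] [NumberField K], poitouTate_sum_localTatePairing_eq_zero K)
    (hEP : ∀ (K : Type) [Field K] [NumberField K] (v : HeightOneSpectrum (𝓞 K)),
      localEulerPoincareCharacteristic (v.adicCompletion K))
    (hK : kato_charIdeal_dvd_multiplicative_of_surjective)
    (hJn : thm61_nonsplitMultiplicative) (hJs : thm61_splitMultiplicative)
    (hHn : exists_isMultCanonical) (hHs : exists_isSplitMultCanonical)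
    (h₁ : padicBSD_nonsplitMult_rankOne) (h₂ : padicBSD_splitMult_rankOne)
    (hGZ1 : GrossZagier1986_thm_I_7_3) (hpar : nonempty_modularParametrizationData)
    (hA : P2OpenInputOnTreeAt W p) (hReg : ClassClosure.RegulatorNonvanishingAt W p)
    (hX : ClassX11b W p) (hp5 : 5 ≤ p) (hsurj : Surj W p)
    (hstar : W.HasSplitMultiplicativeReductionAtPrime p →
      ∃ (m : ℕ) (_ : Fact m.Prime), m ≠ p ∧ W.HasMultiplicativeReductionAtPrime m) :
    BSDp W p :=
  P2.bsdp_of_surj_of_missingUpperBoundAt_endState W p hGZ hKo hWu hGZK hmod hnf hHL hMaz hPT hEP hA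
    (missingUpperBoundAt_of_katoSurj_of_regulatorNonvanishing_primary W p hK hJn hJs hHn hHs h₁ h₂
      hGZ1 hGZK hpar hp5 hX.2.2.1 hX.2.2.2 hX.1 hsurj hstar hReg)
    hX hp5 hsurj

end Summit.BirchSwinnertonDyer.Rank1Residual.X11b

end
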